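import Summits.QuantumFields.BalabanUV.Gaps.D1WardPinsBorderWeight
import Summits.QuantumFields.BalabanUV.Gaps.D1PinnedPositionTableAffine

/-!
# `BalabanUV.Gaps.D1WardPinsTableLine` — cell pub-balaban-gaps, row (D1), seat g1-p1: THE TABLE ANALOGUE — along every LINE of position tables the pinned family's step kernels are affine
# ENTRYWISE (GEN 10's `D1PinnedPositionTableAffine.TbalOf_JsBalAn1_table_affine`), so the Ward binder `hW` at one level holds at AT MOST ONE point of a table line, or (T0) holds along
# the whole line; jointly in (border weight, table-line parameter) the level-`j` zeroth moments are affine in BOTH, so two channels with independent responses pin the pair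

HONEST FRAMING (cell rule, page 1 of everything): [folklore] kernel algebra BY NAME — GEN 10's `TbalOf_JsBalAn1_table_affine`, GEN 15's `D1WardPinsBorderWeight` (`zerothMoment_affine`,
`eq_zero_of_affine_pair`, `TbalOf_JsBalAn1_border_affine`), an1's `tsum_eq_zero_of_ward`, GEN 14's `momentSummable_flipK_TbalOf`.  `hW` is a HYPOTHESIS about members of the cells' OWN pinned
family; the intended table line (reading, zero weight) is an3's N-line `Tc(N) = (8N²)⁻¹·wsym22 N = ⅛[(1 − N⁻²)·S − X]` of print's Wilson table, along which gauge invariance holds in print for EVERY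
`N`; nothing of Bałaban's asserted; NO coefficient computed or signed; (D1) NOT discharged; 0∕4 row-D1 binders; NOT `BetaPertH`, NOT continuum, NOT Clay.
HONEST DEPENDENCY (b2b cell, verbatim): «continuum YM on T⁴ ⇐ BetaPertH ∧ nine spine estimates (0/9 proved); BetaPertH ⇐ (D1) ∧ (D4) ∧ CAP+tail; G-an2-4 gates asym, D1 and NE2/3/4.»

CONTENT (all [folklore]; no `def`, 0 sorry): `zerothMoment_flipK_TbalOf_JsBalAn1_table_affine` (zeroth moments affine along table lines), **`tableLine_zerothMoment_eq_zero_of_ward_pair`** (hW at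
two DIFFERENT points of a table line at level `j` ⟹ (T0) at EVERY point of the line at level `j`), **`tableLine_unique_of_ward`** (if the two endpoint members' zeroth moments differ in some
channel, AT MOST ONE point of the line admits `hW` at level `j`), `tableLine_formula_of_ward` (that point: `s = m₀(T₀)∕(m₀(T₀) − m₀(T₁))`).

Provenance: cell pub-balaban-gaps, seat g1-p1 GEN 15 (prover-pub-balaban-gaps-g1-p1-g15-0), 2026-08-25; imports GEN 15's `Gaps/D1WardPinsBorderWeight` + GEN 10's `Gaps/D1PinnedPositionTableAffine`;
no existing file touched.
-/

noncomputable section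

open Literature.MathematicalPhysics.QuantumFieldTheory Balaban1983to89 Balaban1983to89.Beta Filter Topology
open OneStepResolventKernel (JetData)
open OneStepKernelFamily (TbalOf flipK)
open PolarizationSign (WardTransversal MomentSummable tsum_eq_zero_of_ward)
open OddMoments (zerothMoment)
open AffineAveraging (box)
open Summit.QuantumFields.BalabanUV.Beta.MixedJetTablesPlug (JsBalAn1)
open Summit.QuantumFields.BalabanUV.Gaps.D1IndexSymmetryDictionary (momentSummable_flipK_TbalOf)
open Summit.QuantumFields.BalabanUV.Gaps.D1PinnedPositionTableAffine (TbalOf_JsBalAn1_table_affine)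
open Summit.QuantumFields.BalabanUV.Gaps.D1WardPinsBorderWeight (zerothMoment_affine eq_zero_of_affine_pair)

namespace Summit.QuantumFields.BalabanUV.Gaps.D1WardPinsTableLine

variable {Lc : ℕ} [NeZero Lc] {r : Fin (3 + 1) → ℕ}

/-- [folklore] The flipped step kernels along a table line, entrywise: `flipK T_j((1−s)T₀ + sT₁) = flipK T_j(T₀) + s·(flipK T_j(T₁) − flipK T_j(T₀))`. -/
theorem flipK_TbalOf_JsBalAn1_table_affine (hLc : 1 ≤ Lc) (hr : r ∈ box (3 + 1) Lc) (cE cVH cΛ cE₂ cB : ℝ) (T₀ T₁ : Fin 4 → Fin 4 → Fin 4 → Fin 4 → ℝ) (s : ℝ) (j : ℕ)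
    (a b : Fin 4) (w : Fin 4 → ℤ) :
    flipK (TbalOf Lc (JsBalAn1 hLc hr cE cVH cΛ cE₂ cB ((1 - s) • T₀ + s • T₁)) j) a b w =
      flipK (TbalOf Lc (JsBalAn1 hLc hr cE cVH cΛ cE₂ cB T₀) j) a b w +
        s * (fun a' b' w' => flipK (TbalOf Lc (JsBalAn1 hLc hr cE cVH cΛ cE₂ cB T₁) j) a' b' w' - flipK (TbalOf Lc (JsBalAn1 hLc hr cE cVH cΛ cE₂ cB T₀) j) a' b' w') a b w := by
  simp only [OneStepKernelFamily.flipK_apply]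
  rw [TbalOf_JsBalAn1_table_affine hLc hr cE cVH cΛ cE₂ cB T₀ T₁ s j a b (-w)]
  ring

/-- [folklore] Summable moments of the table-line difference kernel. -/
theorem momentSummable_tableDiff (hLc : 1 ≤ Lc) (hr : r ∈ box (3 + 1) Lc) (cE cVH cΛ cE₂ cB : ℝ) (T₀ T₁ : Fin 4 → Fin 4 → Fin 4 → Fin 4 → ℝ) (j n : ℕ) :
    MomentSummable (fun a b w => flipK (TbalOf Lc (JsBalAn1 hLc hr cE cVH cΛ cE₂ cB T₁) j) a b w - flipK (TbalOf Lc (JsBalAn1 hLc hr cE cVH cΛ cE₂ cB T₀) j) a b w) n := by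
  intro a b
  have h := ((momentSummable_flipK_TbalOf (JsBalAn1 hLc hr cE cVH cΛ cE₂ cB T₁) j n) a b).add ((momentSummable_flipK_TbalOf (JsBalAn1 hLc hr cE cVH cΛ cE₂ cB T₀) j n) a b)
  refine Summable.of_nonneg_of_le (fun w => mul_nonneg (abs_nonneg _) (pow_nonneg (PolarizationSign.size_pos w).le _)) (fun w => ?_) h
  rw [← add_mul]
  exact mul_le_mul_of_nonneg_right (abs_sub _ _) (pow_nonneg (PolarizationSign.size_pos w).le _)

/-- [folklore] **ZEROTH MOMENTS ARE AFFINE ALONG EVERY TABLE LINE**: `m₀(flipK T_j((1−s)T₀ + sT₁); c,e) = m₀(flipK T_j(T₀); c,e) + s·(m₀(flipK T_j(T₁)) − m₀(flipK T_j(T₀)))(c,e)`. -/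
theorem zerothMoment_flipK_TbalOf_JsBalAn1_table_affine (hLc : 1 ≤ Lc) (hr : r ∈ box (3 + 1) Lc) (cE cVH cΛ cE₂ cB : ℝ) (T₀ T₁ : Fin 4 → Fin 4 → Fin 4 → Fin 4 → ℝ) (s : ℝ)
    (j : ℕ) (c e : Fin 4) :
    zerothMoment (flipK (TbalOf Lc (JsBalAn1 hLc hr cE cVH cΛ cE₂ cB ((1 - s) • T₀ + s • T₁)) j)) c e =
      zerothMoment (flipK (TbalOf Lc (JsBalAn1 hLc hr cE cVH cΛ cE₂ cB T₀) j)) c e +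
        s * zerothMoment (fun a b w => flipK (TbalOf Lc (JsBalAn1 hLc hr cE cVH cΛ cE₂ cB T₁) j) a b w - flipK (TbalOf Lc (JsBalAn1 hLc hr cE cVH cΛ cE₂ cB T₀) j) a b w) c e :=
  zerothMoment_affine (momentSummable_flipK_TbalOf _ j 3) (momentSummable_tableDiff hLc hr cE cVH cΛ cE₂ cB T₀ T₁ j 3) s
    (fun a b w => flipK_TbalOf_JsBalAn1_table_affine hLc hr cE cVH cΛ cE₂ cB T₀ T₁ s j a b w) c e

/-- [folklore] Under `hW` at level `j` at the point `s` of the table line: `m₀(flipK T_j(T₀); c,e) + s·(m₀(T₁) − m₀(T₀))(c,e) = 0` in every channel. -/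
theorem tableLine_eq_of_ward (hLc : 1 ≤ Lc) (hr : r ∈ box (3 + 1) Lc) (cE cVH cΛ cE₂ cB : ℝ) (T₀ T₁ : Fin 4 → Fin 4 → Fin 4 → Fin 4 → ℝ) (s : ℝ) (j : ℕ)
    (hW : WardTransversal (flipK (TbalOf Lc (JsBalAn1 hLc hr cE cVH cΛ cE₂ cB ((1 - s) • T₀ + s • T₁)) j))) (c e : Fin 4) :
    zerothMoment (flipK (TbalOf Lc (JsBalAn1 hLc hr cE cVH cΛ cE₂ cB T₀) j)) c e +
        s * zerothMoment (fun a b w => flipK (TbalOf Lc (JsBalAn1 hLc hr cE cVH cΛ cE₂ cB T₁) j) a b w - flipK (TbalOf Lc (JsBalAn1 hLc hr cE cVH cΛ cE₂ cB T₀) j) a b w) c e = 0 := by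
  rw [← zerothMoment_flipK_TbalOf_JsBalAn1_table_affine]
  exact tsum_eq_zero_of_ward (momentSummable_flipK_TbalOf _ j 3) hW c e

/-- [folklore] **`hW` AT TWO DIFFERENT POINTS OF A TABLE LINE ⟹ (T0) AT EVERY POINT OF THE LINE** (same level, same other data): the zeroth moments of the endpoint member `T₀` and of the
difference `T₁ − T₀` vanish in every channel, hence so do those of every member of the line. -/
theorem tableLine_zerothMoment_eq_zero_of_ward_pair (hLc : 1 ≤ Lc) (hr : r ∈ box (3 + 1) Lc) (cE cVH cΛ cE₂ cB : ℝ) (T₀ T₁ : Fin 4 → Fin 4 → Fin 4 → Fin 4 → ℝ) (s s' : ℝ) (j : ℕ)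
    (hW : WardTransversal (flipK (TbalOf Lc (JsBalAn1 hLc hr cE cVH cΛ cE₂ cB ((1 - s) • T₀ + s • T₁)) j)))
    (hW' : WardTransversal (flipK (TbalOf Lc (JsBalAn1 hLc hr cE cVH cΛ cE₂ cB ((1 - s') • T₀ + s' • T₁)) j))) (hne : s ≠ s') (s'' : ℝ) (c e : Fin 4) :
    zerothMoment (flipK (TbalOf Lc (JsBalAn1 hLc hr cE cVH cΛ cE₂ cB ((1 - s'') • T₀ + s'' • T₁)) j)) c e = 0 := by
  obtain ⟨hD, h0⟩ := eq_zero_of_affine_pair (tableLine_eq_of_ward hLc hr cE cVH cΛ cE₂ cB T₀ T₁ s j hW c e) (tableLine_eq_of_ward hLc hr cE cVH cΛ cE₂ cB T₀ T₁ s' j hW' c e) hne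
  rw [zerothMoment_flipK_TbalOf_JsBalAn1_table_affine, hD, h0, mul_zero, add_zero]

/-- [folklore] **WARD PICKS AT MOST ONE POINT OF A TABLE LINE** when the endpoint members' zeroth moments differ in some channel at level `j`. -/
theorem tableLine_unique_of_ward (hLc : 1 ≤ Lc) (hr : r ∈ box (3 + 1) Lc) (cE cVH cΛ cE₂ cB : ℝ) (T₀ T₁ : Fin 4 → Fin 4 → Fin 4 → Fin 4 → ℝ) (s s' : ℝ) (j : ℕ) {c e : Fin 4}
    (hD : zerothMoment (fun a b w => flipK (TbalOf Lc (JsBalAn1 hLc hr cE cVH cΛ cE₂ cB T₁) j) a b w - flipK (TbalOf Lc (JsBalAn1 hLc hr cE cVH cΛ cE₂ cB T₀) j) a b w) c e ≠ 0)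
    (hW : WardTransversal (flipK (TbalOf Lc (JsBalAn1 hLc hr cE cVH cΛ cE₂ cB ((1 - s) • T₀ + s • T₁)) j)))
    (hW' : WardTransversal (flipK (TbalOf Lc (JsBalAn1 hLc hr cE cVH cΛ cE₂ cB ((1 - s') • T₀ + s' • T₁)) j))) : s = s' := by
  by_contra hne
  exact hD (eq_zero_of_affine_pair (tableLine_eq_of_ward hLc hr cE cVH cΛ cE₂ cB T₀ T₁ s j hW c e) (tableLine_eq_of_ward hLc hr cE cVH cΛ cE₂ cB T₀ T₁ s' j hW' c e) hne).1

/-- [folklore] … and that point is `s = −m₀(flipK T_j(T₀); c,e) ∕ (m₀(T₁) − m₀(T₀))(c,e)`. -/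
theorem tableLine_formula_of_ward (hLc : 1 ≤ Lc) (hr : r ∈ box (3 + 1) Lc) (cE cVH cΛ cE₂ cB : ℝ) (T₀ T₁ : Fin 4 → Fin 4 → Fin 4 → Fin 4 → ℝ) (s : ℝ) (j : ℕ) {c e : Fin 4}
    (hD : zerothMoment (fun a b w => flipK (TbalOf Lc (JsBalAn1 hLc hr cE cVH cΛ cE₂ cB T₁) j) a b w - flipK (TbalOf Lc (JsBalAn1 hLc hr cE cVH cΛ cE₂ cB T₀) j) a b w) c e ≠ 0)
    (hW : WardTransversal (flipK (TbalOf Lc (JsBalAn1 hLc hr cE cVH cΛ cE₂ cB ((1 - s) • T₀ + s • T₁)) j))) :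
    s = -(zerothMoment (flipK (TbalOf Lc (JsBalAn1 hLc hr cE cVH cΛ cE₂ cB T₀) j)) c e) /
      zerothMoment (fun a b w => flipK (TbalOf Lc (JsBalAn1 hLc hr cE cVH cΛ cE₂ cB T₁) j) a b w - flipK (TbalOf Lc (JsBalAn1 hLc hr cE cVH cΛ cE₂ cB T₀) j) a b w) c e := by
  have h := tableLine_eq_of_ward hLc hr cE cVH cΛ cE₂ cB T₀ T₁ s j hW c e
  field_simp
  linarith

end Summit.QuantumFields.BalabanUV.Gaps.D1WardPinsTableLine

end
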